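import Summits.QuantumFields.YangMills.Theorems.UnitScaleTiltHistoryTailDiluteCore
import Summits.QuantumFields.YangMills.Theorems.AlphaInputsT3ACv2RecHistories

/-!
# Route `UnitScaleTilt` — crux K2-L `HistoryTailL` (stmt-QuantumFields-19936), STUB 4c `stub_diluteExponent`: SMALL LEMMAS FOR THE WRAPPER — offsets vs the
# torus distance, the printed collars along the T³ flow, the arithmetic of the level counts (support file)

Fleet lead `ym-ust-18916-p1` (gen 3), 2026-08-27.

* `min_val_le_natAbs`, `tdist_le_of_offsets` — a fine site given by coordinate offsets `|e_ι| ≤ ρ` from another is at `ℓ¹` distance `≤ d·ρ`;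
* `rcolOf_le` — the lane's collar `Rcol_l = ⌈R₁(1 + log g_l⁻¹)^{r₀}⌉M₁ ≤ (R₁x_l^{r₀} + 1)·M₁` with `g_l = √(γL^{−(K−l)})` (`T3Scales_gk_eq`);
* `natCnt_le` — `(2(2dρ/L^l) + 1)^d ≤ (4dB + 1)^d` when `ρ ≤ B·L^l`.

References: T. Bałaban, CMP 102 (1985) 255–275 [Balaban1985UV3] ((39) p.266).
-/

noncomputable section

open scoped BigOperators

namespace Summit.QuantumFields.YangMills.Theorems.HistoryTailDiluteLemmas

open Literature.MathematicalPhysics.QuantumFieldTheory.Balaban1983to89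
open Literature.MathematicalPhysics.QuantumFieldTheory.Balaban1983to89.T3ContinuumYM3Torus
open B10LargeField (xlog)
open Summit.QuantumFields.Balaban3D.Carriers
open Summit.QuantumFields.Balaban3D.Proofs.Primitives
open Summit.QuantumFields.YangMills.Theorems (T3Scales_gk_eq)

/-! ## §1 Offsets and the torus distance -/

/-- For an integer `e` and `N > 0`: `min (val e) (val (−e)) ≤ |e|` in `ZMod N`. [folklore] -/
theorem min_val_le_natAbs {N : ℕ} [NeZero N] (e : ℤ) :
    min ((e : ZMod N)).val ((-(e : ZMod N))).val ≤ e.natAbs := by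
  have hN : (0 : ℤ) < N := by exact_mod_cast Nat.pos_of_ne_zero (NeZero.ne N)
  have key : ∀ f : ℤ, 0 ≤ f → ((f : ZMod N)).val ≤ f.natAbs := by
    intro f hf
    have h1 : (((f : ZMod N)).val : ℤ) = f % N := ZMod.val_intCast f
    have h2 : f % N ≤ f := by
      have h3 := Int.ediv_nonneg hf hN.le
      have h4 := Int.emod_add_mul_ediv f N
      nlinarith
    have h5 : (f.natAbs : ℤ) = f := Int.natAbs_of_nonneg hf
    omega
  rcases le_or_gt 0 e with he | he
  · exact (min_le_left _ _).trans (key e he)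
  · have h := key (-e) (by omega)
    rw [Int.natAbs_neg] at h
    refine (min_le_right _ _).trans ?_
    rwa [Int.cast_neg] at h

/-- **OFFSETS CONTROL THE TORUS DISTANCE**: if every coordinate of `x` is that of `y` shifted by an integer `e_ι` with `|e_ι| ≤ ρ`, then `tdist x y ≤ d·ρ`.
[cite: Balaban1985UV3, (38) p.266] -/
theorem tdist_le_of_offsets {P : Params} {x y : Site P 0} {ρ : ℤ}
    (h : ∀ ι, ∃ e : ℤ, |e| ≤ ρ ∧ x ι = y ι + (e : ZMod (P.sitesPerDir 0))) : (Site.tdist x y : ℝ) ≤ P.d * ρ := by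
  have hcoord : ∀ ι, (min (x ι - y ι).val (y ι - x ι).val : ℤ) ≤ ρ := by
    intro ι
    obtain ⟨e, he, hxe⟩ := h ι
    have h1 : x ι - y ι = (e : ZMod (P.sitesPerDir 0)) := by rw [hxe]; ring
    have h2 : y ι - x ι = -(e : ZMod (P.sitesPerDir 0)) := by rw [hxe]; ring
    rw [h1, h2]
    have := min_val_le_natAbs (N := P.sitesPerDir 0) e
    have h3 : (e.natAbs : ℤ) ≤ ρ := by rw [Int.natCast_natAbs]; exact he
    omega
  have hsum : (Site.tdist x y : ℤ) ≤ P.d * ρ := by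
    unfold Site.tdist
    push_cast
    calc ∑ ι : Fin P.d, (min (x ι - y ι).val (y ι - x ι).val : ℤ) ≤ ∑ _ι : Fin P.d, ρ := Finset.sum_le_sum fun ι _ => hcoord ι
      _ = P.d * ρ := by rw [Finset.sum_const, Finset.card_univ, Fintype.card_fin, nsmul_eq_mul]
  exact_mod_cast hsum

/-! ## §2 The collars along the flow -/

/-- **THE LANE'S COLLAR ALONG THE T³ FLOW**: `Rcol_l = ⌈R₁(1 + log g_l⁻¹)^{r₀}⌉·M₁ ≤ (R₁·x_l^{r₀} + 1)·M₁`, `x_l = 1 + log(√(γL^{−(K−l)}))⁻¹`, for `l ≤ K`.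
[cite: Balaban1985UV3, (39) p.266] -/
theorem rcolOf_le (F : T3Family) (γ : ℝ) (hγ : 0 < γ) (hγ1 : γ ≤ 1) (K : ℕ) (C : CarrierConsts) (hR : 0 ≤ C.R₁) (l : ℕ) (hl : l ≤ K) :
    ((rcolOf (T3Scales F γ hγ hγ1 K) C l : ℕ) : ℝ) ≤ (C.R₁ * xlog (Real.sqrt (γ * ((F.L : ℝ)⁻¹) ^ (K - l))) ^ C.r₀ + 1) * C.M₁ := by
  unfold rcolOf
  rw [T3Scales_gk_eq F γ hγ hγ1 K l hl]
  have h0 : 0 ≤ C.R₁ * B10.rFun C.r₀ (Real.sqrt (γ * ((F.L : ℝ)⁻¹) ^ (K - l))) := by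
    refine mul_nonneg hR ?_
    unfold B10.rFun
    refine Real.rpow_nonneg ?_ _
    have := HistoryTailTowerReach.one_le_xlog_coupling hγ hγ1 (by exact_mod_cast F.hL.2.le : (1 : ℝ) ≤ F.L) (K - l)
    unfold xlog at this
    linarith
  have hceil := (Nat.ceil_lt_add_one h0).le
  push_cast
  refine mul_le_mul_of_nonneg_right ?_ (Nat.cast_nonneg _)
  exact hceil

/-! ## §3 The level counts -/

/-- `(2(2dρ/L^l) + 1)^d ≤ (4dB + 1)^d` (naturals, read in `ℝ`) when `ρ ≤ B·L^l`. [folklore] -/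
theorem natCnt_le {d L l ρ : ℕ} (hL : 0 < L) {B : ℝ} (h : (ρ : ℝ) ≤ B * (L : ℝ) ^ l) :
    (((2 * (2 * d * ρ / L ^ l) + 1) ^ d : ℕ) : ℝ) ≤ (4 * d * B + 1) ^ d := by
  have hLl : (0 : ℝ) < (L : ℝ) ^ l := by positivity
  have h1 : ((2 * d * ρ / L ^ l : ℕ) : ℝ) ≤ 2 * d * B := by
    calc ((2 * d * ρ / L ^ l : ℕ) : ℝ) ≤ ((2 * d * ρ : ℕ) : ℝ) / ((L ^ l : ℕ) : ℝ) := Nat.cast_div_le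
      _ = 2 * d * (ρ : ℝ) / (L : ℝ) ^ l := by push_cast; ring
      _ ≤ 2 * d * (B * (L : ℝ) ^ l) / (L : ℝ) ^ l := by gcongr
      _ = 2 * d * B := by field_simp
  have h2 : (((2 * (2 * d * ρ / L ^ l) + 1 : ℕ)) : ℝ) ≤ 4 * d * B + 1 := by push_cast; linarith
  push_cast
  have h3 : (0 : ℝ) ≤ ((2 * (2 * d * ρ / L ^ l) + 1 : ℕ) : ℝ) := Nat.cast_nonneg _
  have := pow_le_pow_left₀ h3 h2 d
  exact_mod_cast this

end Summit.QuantumFields.YangMills.Theorems.HistoryTailDiluteLemmas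

end
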